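import Summits.QuantumAdvantage.QuantumAdvantage.Theses.ArithStatLadder
import Summits.QuantumAdvantage.QuantumAdvantage.Theorems.ArithStatLadderAvgFaceBeyondPriorHeurTransfer

/-!
# Route `ArithStatLadder`, item `MirrorHeurTransfer` (stmt-QuantumAdvantage-15006)

The support (glue) item of route `QuantumAdvantage/ArithStatLadder` — the **mirror transfer**: if a
set `T ⊆ ℕ` agrees with `IQ3 = {d : −d fundamental, 3 ∣ h(−d)}` off a `(1/6 + ε)`-fraction of
every late dyadic block `𝒟ₙ = {n-bit d : −d fundamental}`, for every `ε > 0`, and the binary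
language of `T` is in `BPP`, then `(IQ3, U) ∈ Heur_{1/3}BPP`, i.e. `¬ AvgFaceBeyondPrior`.

Reason (Bogdanov–Trevisan 2006, §2.3; generic heuristic-class plumbing): amplify the `BPP` machine
to error `≤ 1/8`, truncate coins and lift to `(x, 1ⁿ)`; from the agreement level `n₀` on, the bad
set (coin error `≥ 1/4` about `IQ3`) lies in the disagreement set, of `Uₙ`-mass `≤ 1/6 + 1/6 =
1/3`; below `n₀` patch with the finite table of `IQ3`, bad mass `0`. This is the landed tree theorem
`Summit.QuantumAdvantage.QuantumAdvantage.Theorems.AvgFaceBeyondPrior.Mirror.stub_heurTransfer`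
(`Theorems/ArithStatLadderAvgFaceBeyondPriorHeurTransfer.lean`), stated over `Negative.fundBlock n`,
which is by definition the route's literal finset; so the item is that theorem re-typed against the
route decl.
-/

set_option linter.dupNamespace false -- D-0017: single-problem summit ⇒ `QuantumAdvantage.QuantumAdvantage` by design

namespace Summit.QuantumAdvantage.QuantumAdvantage.Theorems.ArithStatLadder

/-- Settles `stmt-QuantumAdvantage-15006` (route ArithStatLadder, support): the mirror transfer
`MirrorHeurTransfer` — a set `T` agreeing with `IQ3` off a `(1/6 + ε)`-fraction of every late block
with `bin T ∈ BPP` puts `(IQ3, U)` in `Heur_{1/3}BPP`, refuting `AvgFaceBeyondPrior`. It is the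
landed tree theorem `Theorems.AvgFaceBeyondPrior.Mirror.stub_heurTransfer` (error reduction to
`1/8`, coin truncation, parameter lift, finite-table patch below the agreement level), whose block
`Negative.fundBlock n` unfolds definitionally to the route's literal finset.
[cite: BogdanovTrevisan2006, §2.3] [cite: AroraBarakCC2009, §7.4] -/
theorem MirrorHeurTransfer_proof :
    Summit.QuantumAdvantage.QuantumAdvantage.Theses.ArithStatLadder.MirrorHeurTransfer := by
  unfold Summit.QuantumAdvantage.QuantumAdvantage.Theses.ArithStatLadder.MirrorHeurTransfer
  exact Summit.QuantumAdvantage.QuantumAdvantage.Theorems.AvgFaceBeyondPrior.Mirror.stub_heurTransfer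

end Summit.QuantumAdvantage.QuantumAdvantage.Theorems.ArithStatLadder
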